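import Literature.AlgebraicGeometry.Motives.AbelianVarietyHondaTate
import Summits.RiemannHypothesis.RiemannHypothesis.Theorems.PfPersistenceFfWeilCriterion
import Summits.RiemannHypothesis.RiemannHypothesis.Theorems.MotivicDoorFfWeilConverse

/-!
# The function-field door (FF-DOOR, statement (ii)): for honest Weil data, the Riemann hypothesis
# IS geometric (abelian-variety) origin up to a power — and what that says about the window route
(pub-rhdoor, seat ff-2; HONEST FRAMING: lottery ticket at the motivic door; RH probability negligible;
consolation prizes are real: a new semi-local Weil-positivity theorem, or a located gap in the
Connes–Consani programme, plus the ff-door theorem.  Nothing in this file is a statement about `ζ`.)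

Setting.  `K = 𝔽_q` a finite field (`q = Nat.card K`), `h ∈ ℤ[x]` monic of positive degree — a candidate
"characteristic polynomial of Frobenius" — with complex root multiset `frobRoots h`
(`PfPersistenceFfAngleTwin`).  `RH(q, h)` is `∀ α ∈ frobRoots h, |α| = √q`.  GEOMETRIC ORIGIN of `h` over
`K` is `∃ C : AbelianVariety K, C.IsFrobCharpoly h`: `h` is the (ℓ-independent, `ℓ ≠ p`) characteristic
polynomial of the Frobenius endomorphism `π_C` on the Tate modules `T_ℓ C` of an abelian variety `C/K`
(`Literature.AlgebraicGeometry.Motives.AbelianVariety.IsFrobCharpoly`, pinned to the tree's PROVED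
`exists_charpoly_tateModuleMap_frobeniusHom_eq_map`, Mumford §19 Thm. 4 / Milne Thm. 19.1 (a)).

The two classical inputs enter as NAMED LITERATURE HYPOTHESES (D-0014), verbatim in
`Literature/AlgebraicGeometry/Motives/AbelianVarietyHondaTate.lean`:
`hW : ∀ A, A.weilRiemannHypothesis` — Weil 1948 / Milne 1986 Thm. 19.1 (c) "(Riemann hypothesis)
`|a_i| = q^{1/2}`"; `hHT : hondaTateExistence K` — Honda 1968 Main Thm. / Tate, Bourbaki 352 Th. 1 /
Waterhouse 1969 Ch. 2: every Weil `q`-number `π` (minimal polynomial `m`) is the Frobenius of a simple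
abelian variety `A/𝔽_q`, and then `P_A = m^e` with `e ≥ 1` the period of `End⁰ A` in `Br(ℚ(π))`.

PROVED here (kernel, from `hW`, `hHT` and tree theorems only; labels per sentence):
* `rh_iff_exists_pow_geometric` — **FF-DOOR THEOREM**: `RH(q, h) ↔ ∃ E ≥ 1, h^E is geometric over 𝔽_q`.
  [PROVED from hW (⇐) and hHT (⇒); the product step `P_{A×B} = P_A P_B` and the factorisation into Weil
  numbers are tree theorems, not inputs.]
* `rh_of_geometric_pow` (⇐, Weil only) and `exists_pow_geometric_of_rh` (⇒, Honda–Tate only): the two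
  halves with their exact trust bases.  [PROVED]
* `weilWindowForm_posSemidef_of_geometric_pow` — geometric (up to a power) ⇒ EVERY window form
  `T_M(q, h)` is positive semidefinite (hW + `PfPersistenceFfGram`).  [PROVED]
* `windows_posSemidef_iff_exists_pow_geometric` — for data with roots closed under `α ↦ q/α` and
  `h(0) ≠ 0`: `(∀ M, T_M(q,h) ⪰ 0) ↔ RH(q,h) ↔ geometric up to a power`, joining door D-D
  (`PfPersistenceFfWeilCriterion`, ffmirror-2) to the motivic door; and
  `honest_rh_iff_geometric_and_windows_iff_geometric` — the same for HONEST data in the cell's coefficient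
  typing (monic, degree `2g ≥ 2`, `q^g c_j = q^i c_i`), via ff-1's `weilWindowForm_posSemidef_iff_ffRH`.  [PROVED]
* `geo_weil`, `geo_hondaTate_powerForm` — the hypotheses `hW`, `hHT` of FF-DOOR §(i) (ff-1, abstract
  `Geo`) DISCHARGED for `Geo h := ∃ A : AbelianVariety K, A.IsFrobCharpoly h`.  [PROVED]
* `exists_geometric_scaleInvariant_eq` — **DOOR-BLINDNESS**: for every RH-true honest datum `(q, h)` and
  every SCALE-INVARIANT tower functional `Φ` there is an abelian variety `C/𝔽_q` whose genuine tower `Φ`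
  cannot tell from that of `(q, h)` (hHT + `scaleInvariant_eq_of_pow`).  So no scale-invariant window
  reader separates honest fakes from geometric data: past RH, "geometric origin" is invisible to the window
  route except through the exponent `E`, an arithmetic invariant of `(q, h)` (Honda–Tate's `e`).  [PROVED]
* `frobRoots_norm_eq_of_trace_sq` and `exists_pow_geometric_traceSq` — the twin instances of
  `PfPersistenceFfAngleTwin`: `h_t = x² - t x + t²` over `𝔽_{t²}` is RH-true for every `t ≥ 1` [PROVED],
  hence geometric up to a power [PROVED from hHT]; for `t = 2` (`q = 4`) `E = 1` (elliptic curve 1.4.ac)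
  and for `t = 7` (`q = 49`) the minimal exponent is `E = 2` (Waterhouse 1969 Thm. 4.1: `x² - 7x + 49` is
  not a `P_A`; Honda–Tate invariants `1/2, 1/2` at the two primes of `ℚ(√-3)` over `7`) [DATA / cited,
  not formalised] — while the two towers coincide identically (`windowForm_4_49`, PROVED there).

CAVEATS made explicit (see HOME/FF-DOOR.md): (1) POWERS: the exponent `E` cannot be dropped — real Weil
numbers `±√q` and Brauer obstructions force `e > 1` (Waterhouse p. 528); the door theorem is an
equivalence of RH with geometric origin UP TO A POWER, and `E = 1` ("honest fake" vs "genuine") is decided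
by Honda–Tate's arithmetic `e`, not by any root-location statement.  (2) `q` vs `qⁿ`: geometric origin is
relative to the constant field `K`; base change `𝔽_q → 𝔽_{qⁿ}` replaces roots `α` by `αⁿ`, a different
operation from `h ↦ h^E` (same `q`, multiplicities × `E`).  (3) ORDINARY vs SUPERSINGULAR: for ordinary
Weil numbers `e = 1` always; all `e > 1` phenomena are non-ordinary (not formalised; Waterhouse Ch. 7).
(4) Nothing transfers to the number-field door by analogy alone: there the analogue of `hHT` (every
"honest" datum is motivic) is exactly what is missing.
-/

set_option linter.dupNamespace false  -- the mandated namespace repeats `RiemannHypothesis`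

open Polynomial
open scoped ComplexOrder

namespace Summit.RiemannHypothesis.RiemannHypothesis.Theorems.MotivicDoor.FunctionField

open Literature.AlgebraicGeometry.Motives
open Summit.RiemannHypothesis.RiemannHypothesis.Theorems.PfPersistence.FfAngleTwin

universe u

variable {K : Type u} [Field K] [Finite K]

/-! ## The door theorem and its two halves -/

/-- **FF-DOOR THEOREM (statement (ii)).**  Over a finite field `K = 𝔽_q`, for a monic `h ∈ ℤ[x]` of
positive degree, GIVEN Weil's Riemann hypothesis for abelian varieties (`hW`) and the existence half of
Honda–Tate (`hHT`): all complex roots of `h` have absolute value `√q` if and only if some power `h^E`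
(`E ≥ 1`) is the characteristic polynomial of the Frobenius of an abelian variety over `K`.
[PROVED from the two named Literature facts; `Literature…weil_iff_exists_pow_isFrobCharpoly` in the
vocabulary `frobRoots` of the function-field mirror.] -/
theorem rh_iff_exists_pow_geometric (hW : ∀ A : AbelianVariety K, A.weilRiemannHypothesis)
    (hHT : AbelianVariety.hondaTateExistence K) {h : ℤ[X]} (hm : h.Monic) (hdeg : 0 < h.natDegree) :
    (∀ α ∈ frobRoots h, ‖α‖ = Real.sqrt (Nat.card K)) ↔
      ∃ E : ℕ, 0 < E ∧ ∃ C : AbelianVariety K, C.IsFrobCharpoly (h ^ E) :=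
  AbelianVariety.weil_iff_exists_pow_isFrobCharpoly hW hHT hm hdeg

/-- **(⇐) Geometric data are RH-true — Weil only.**  If `h^E` (`E ≥ 1`) is the characteristic
polynomial of the Frobenius of some `C/K`, then `RH(q, h)`.  Trust base: `weilRiemannHypothesis` alone
(no Honda–Tate, no hypothesis on `h`). [PROVED] -/
theorem rh_of_geometric_pow (hW : ∀ A : AbelianVariety K, A.weilRiemannHypothesis) {h : ℤ[X]} {E : ℕ}
    (hE : 0 < E) {C : AbelianVariety K} (hC : C.IsFrobCharpoly (h ^ E)) :
    ∀ α ∈ frobRoots h, ‖α‖ = Real.sqrt (Nat.card K) :=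
  AbelianVariety.weil_of_isFrobCharpoly_pow hW hE hC

/-- **(⇒) No honest fakes up to powers — Honda–Tate only.**  Every RH-true monic `h` of positive degree
has a power which is the characteristic polynomial of the Frobenius of an abelian variety over `K`.
Trust base: `hondaTateExistence K` alone. [PROVED] -/
theorem exists_pow_geometric_of_rh (hHT : AbelianVariety.hondaTateExistence K) {h : ℤ[X]}
    (hm : h.Monic) (hdeg : 0 < h.natDegree) (hRH : ∀ α ∈ frobRoots h, ‖α‖ = Real.sqrt (Nat.card K)) :
    ∃ E : ℕ, 0 < E ∧ ∃ C : AbelianVariety K, C.IsFrobCharpoly (h ^ E) :=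
  AbelianVariety.exists_pow_isFrobCharpoly_of_weil hHT hm hdeg hRH

/-! ## Consequences for the window route (doors D-D and E-MOT of the function-field mirror) -/

omit [Finite K] in
/-- `q = #K > 0` as a real number. [PROVED] -/
theorem natCard_pos_real [Finite K] : (0 : ℝ) < Nat.card K := by
  exact_mod_cast (Nat.card_pos (α := K))

/-- **Geometric ⇒ every window is positive semidefinite.**  If some power of `h` is the characteristic
polynomial of the Frobenius of an abelian variety over `K`, then every window form `T_M(q, h)`, `M ≥ 0`,
is positive semidefinite (Weil's RH + the Gram representation `PfPersistenceFfGram`). [PROVED] -/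
theorem weilWindowForm_posSemidef_of_geometric_pow (hW : ∀ A : AbelianVariety K, A.weilRiemannHypothesis)
    {h : ℤ[X]} {E : ℕ} (hE : 0 < E) {C : AbelianVariety K} (hC : C.IsFrobCharpoly (h ^ E)) (M : ℕ) :
    (weilWindowForm (Nat.card K) h M).PosSemidef :=
  weilWindowForm_posSemidef natCard_pos_real (rh_of_geometric_pow hW hE hC) M

/-- **Window positivity ⟺ geometric origin up to a power**, for honest data.  For monic `h` of positive
degree whose complex roots are closed under `α ↦ q/α` (functional equation) and exclude `0`:
ALL window forms `T_M(q, h)` are positive semidefinite iff some power of `h` is the characteristic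
polynomial of a Frobenius over `K` — door D-D (`weilWindowForm_posSemidef_forall_iff`) composed with the
FF-door theorem. [PROVED from hW, hHT] -/
theorem windows_posSemidef_iff_exists_pow_geometric
    (hW : ∀ A : AbelianVariety K, A.weilRiemannHypothesis)
    (hHT : AbelianVariety.hondaTateExistence K) {h : ℤ[X]} (hm : h.Monic) (hdeg : 0 < h.natDegree)
    (hrec : (frobRoots h).map (fun α => ((Nat.card K : ℝ) : ℂ) / α) = frobRoots h)
    (h0 : (0 : ℂ) ∉ frobRoots h) :
    (∀ M, (weilWindowForm (Nat.card K) h M).PosSemidef) ↔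
      ∃ E : ℕ, 0 < E ∧ ∃ C : AbelianVariety K, C.IsFrobCharpoly (h ^ E) :=
  (weilWindowForm_posSemidef_forall_iff natCard_pos_real hrec h0).trans
    (rh_iff_exists_pow_geometric hW hHT hm hdeg)

/-- **FF-DOOR THEOREM for HONEST data, three ways.**  For `h` monic of degree `2g ≥ 2` satisfying the
coefficient functional equation `q^g c_j = q^i c_i` (`i + j = 2g`; the cell's typing of "honest", FF-DOOR.md
§(i).A) over `K = 𝔽_q`:  `RH(q,h) ⟺ ∃ E ≥ 1, h^E geometric over K`, and `(∀ M, T_M(q,h) ⪰ 0) ⟺ ∃ E ≥ 1, h^E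
geometric over K` — the window tower of an honest datum carries exactly geometric-origin-up-to-a-power
(ff-1's `weilWindowForm_posSemidef_iff_ffRH` composed with the door theorem). [PROVED from hW, hHT] -/
theorem honest_rh_iff_geometric_and_windows_iff_geometric
    (hW : ∀ A : AbelianVariety K, A.weilRiemannHypothesis)
    (hHT : AbelianVariety.hondaTateExistence K) {h : ℤ[X]} {g : ℕ} (hg : 1 ≤ g) (hm : h.Monic)
    (hdeg : h.natDegree = 2 * g)
    (hFE : ∀ i j, i + j = 2 * g → (Nat.card K : ℤ) ^ g * h.coeff j = (Nat.card K : ℤ) ^ i * h.coeff i) :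
    ((∀ α ∈ frobRoots h, ‖α‖ = Real.sqrt (Nat.card K)) ↔
        ∃ E : ℕ, 0 < E ∧ ∃ B : AbelianVariety K, B.IsFrobCharpoly (h ^ E)) ∧
      ((∀ M, (weilWindowForm (Nat.card K) h M).PosSemidef) ↔
        ∃ E : ℕ, 0 < E ∧ ∃ B : AbelianVariety K, B.IsFrobCharpoly (h ^ E)) :=
  have hdeg' : 0 < h.natDegree := by omega
  ⟨rh_iff_exists_pow_geometric hW hHT hm hdeg',
    (weilWindowForm_posSemidef_iff_ffRH Nat.card_pos hdeg hFE).trans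
      (rh_iff_exists_pow_geometric hW hHT hm hdeg')⟩

/-! ## Instantiating the abstract `Geo` of FF-DOOR §(i) (ff-1) by abelian-variety origin
`Geo h := ∃ A : AbelianVariety K, A.IsFrobCharpoly h`: the two hypotheses `hW`, `hHT` of §(i).A in exactly
ff-1's shape, discharged from the named Literature facts. -/

/-- ff-1's `hW` (§(i).A): geometric data are RH-true. [PROVED from `weilRiemannHypothesis`] -/
theorem geo_weil (hW : ∀ A : AbelianVariety K, A.weilRiemannHypothesis) :
    ∀ h : ℤ[X], (∃ A : AbelianVariety K, A.IsFrobCharpoly h) →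
      ∀ α ∈ frobRoots h, ‖α‖ = Real.sqrt (Nat.card K) :=
  fun h ⟨A, hA⟩ => hW A h hA

/-- ff-1's `hHT` in POWER FORM (§(i).A): every honest RH-true datum of dimension `g ≥ 1` has a geometric
power.  (The functional equation and the evenness of the degree are not even needed: `exists_pow_geometric_of_rh`.)
[PROVED from `hondaTateExistence`] -/
theorem geo_hondaTate_powerForm (hHT : AbelianVariety.hondaTateExistence K) :
    ∀ (g : ℕ) (h : ℤ[X]), 1 ≤ g → h.Monic → h.natDegree = 2 * g →
      (∀ i j, i + j = 2 * g → (Nat.card K : ℤ) ^ g * h.coeff j = (Nat.card K : ℤ) ^ i * h.coeff i) →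
      (∀ α ∈ frobRoots h, ‖α‖ = Real.sqrt (Nat.card K)) →
      ∃ E : ℕ, 0 < E ∧ ∃ A : AbelianVariety K, A.IsFrobCharpoly (h ^ E) :=
  fun _g _h hg hm hdeg _hFE hRH => exists_pow_geometric_of_rh hHT hm (by omega) hRH

/-- **DOOR-BLINDNESS of scale-invariant window readers.**  For every RH-true monic `h` of positive degree
over `K = 𝔽_q` and every SCALE-INVARIANT tower functional `Φ` (normalised eigenvectors, sign patterns,
eigenvalue ratios, …: `Φ (c • T) = Φ T` for `c > 0`) there is an abelian variety `C/𝔽_q`, with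
characteristic polynomial of Frobenius `P`, such that `Φ` takes the same value on the genuine tower of
`(q, P)` as on the tower of `(q, h)` — at the SAME `q`.  (`P = h^E` from Honda–Tate; `T_M(q, h^E) =
E · T_M(q, h)`.)  Hence no such reader separates honest fakes from geometric data. [PROVED from hHT] -/
theorem exists_geometric_scaleInvariant_eq (hHT : AbelianVariety.hondaTateExistence K) {β : Sort*}
    {Φ : Tower → β} (hΦ : ∀ (c : ℝ), 0 < c → ∀ T : Tower, Φ (Tower.scale c T) = Φ T) {h : ℤ[X]}
    (hm : h.Monic) (hdeg : 0 < h.natDegree) (hRH : ∀ α ∈ frobRoots h, ‖α‖ = Real.sqrt (Nat.card K)) :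
    ∃ (C : AbelianVariety K) (P : ℤ[X]), C.IsFrobCharpoly P ∧
      Φ (weilWindowTower (Nat.card K) P) = Φ (weilWindowTower (Nat.card K) h) := by
  obtain ⟨E, hE, C, hC⟩ := AbelianVariety.exists_pow_isFrobCharpoly_of_weil hHT hm hdeg hRH
  exact ⟨C, h ^ E, hC, scaleInvariant_eq_of_pow hΦ _ h hE⟩

/-! ## The twin instances `x² - t x + t²` over `𝔽_{t²}` (`t = 2`: `q = 4`; `t = 7`: `q = 49`) -/

/-- `h_t = x² - t x + t²` is monic. [PROVED] -/
theorem monic_traceSq (t : ℕ) : (X ^ 2 - C (t : ℤ) * X + C ((t : ℤ) ^ 2) : ℤ[X]).Monic := by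
  monicity!

/-- `deg h_t = 2`. [PROVED] -/
theorem natDegree_traceSq (t : ℕ) : (X ^ 2 - C (t : ℤ) * X + C ((t : ℤ) ^ 2) : ℤ[X]).natDegree = 2 := by
  compute_degree!

/-- **`h_t = x² - t x + t²` is RH-true over `𝔽_{t²}`**: every complex root `α` satisfies
`(α + t)(α² - tα + t²) = α³ + t³ = 0`, so `|α|³ = t³` and `|α| = t = √(t²)`.  (`t = 2`: roots `1 ± i√3`,
`q = 4`; `t = 7`: roots `(7 ± 7i√3)/2`, `q = 49` — the twin pair of `PfPersistenceFfAngleTwin`.) [PROVED] -/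
theorem frobRoots_norm_eq_of_traceSq (t : ℕ) :
    ∀ α ∈ frobRoots (X ^ 2 - C (t : ℤ) * X + C ((t : ℤ) ^ 2)), ‖α‖ = t := by
  intro α hα
  have hne : (X ^ 2 - C (t : ℤ) * X + C ((t : ℤ) ^ 2) : ℤ[X]).map (Int.castRingHom ℂ) ≠ 0 :=
    ((monic_traceSq t).map _).ne_zero
  have hroot := (Polynomial.mem_roots hne).1 hα
  have h2 : α ^ 2 - (t : ℂ) * α + (t : ℂ) ^ 2 = 0 := by
    simpa [Polynomial.eval_map] using hroot
  have h3 : α ^ 3 = -((t : ℂ) ^ 3) := by linear_combination (α + t) * h2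
  have hn : ‖α‖ ^ 3 = (t : ℝ) ^ 3 := by
    rw [← norm_pow, h3, norm_neg, norm_pow, Complex.norm_natCast]
  exact (pow_left_inj₀ (norm_nonneg α) (Nat.cast_nonneg t) three_ne_zero).1 hn

/-- **The twin instances are geometric up to a power** (Honda–Tate): over a field `K` with `t²` elements,
some power of `h_t = x² - t x + t²` is the characteristic polynomial of the Frobenius of an abelian variety
over `K`.  [PROVED from hHT.  DATA, not formalised: for `t = 2` the exponent `E = 1` works (isogeny class
1.4.ac of elliptic curves over `𝔽_4`); for `t = 7` the least exponent is `E = 2` — `x² - 7x + 49` is not a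
characteristic polynomial of Frobenius over `𝔽_49` (Waterhouse 1969, Thm. 4.1), while `(x² - 7x + 49)²` is
that of a simple abelian surface (Honda–Tate invariants `1/2, 1/2` at the two primes of `ℚ(√-3)` above `7`).] -/
theorem exists_pow_geometric_traceSq (hHT : AbelianVariety.hondaTateExistence K) {t : ℕ}
    (hK : Nat.card K = t ^ 2) :
    ∃ E : ℕ, 0 < E ∧ ∃ B : AbelianVariety K,
      B.IsFrobCharpoly ((X ^ 2 - C (t : ℤ) * X + C ((t : ℤ) ^ 2)) ^ E) := by
  refine exists_pow_geometric_of_rh hHT (monic_traceSq t) (by rw [natDegree_traceSq]; exact two_pos) ?_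
  intro α hα
  rw [frobRoots_norm_eq_of_traceSq t α hα, hK]
  push_cast
  exact (Real.sqrt_sq (Nat.cast_nonneg _)).symm

/-- **The twin pair through the door.**  With `K₄`, `K₄₉` fields of `4` and `49` elements: both
`(4, x² - 2x + 4)` and `(49, x² - 7x + 49)` are geometric up to a power over their own fields [PROVED from
hHT], and every tower functional takes the same value on the two data (`weilTowerFunctional_eq_of_twin` with
`twin_4_49`, PROVED in `PfPersistenceFfAngleTwin` on the explicit root multisets) — geometric origin is
`q`-relative and, beyond RH, invisible to the window tower. [PROVED] -/
theorem twin_pair_geometric_pow {K₄ K₄₉ : Type u} [Field K₄] [Finite K₄] [Field K₄₉] [Finite K₄₉]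
    (h4 : Nat.card K₄ = 4) (h49 : Nat.card K₄₉ = 49) (hHT₄ : AbelianVariety.hondaTateExistence K₄)
    (hHT₄₉ : AbelianVariety.hondaTateExistence K₄₉) :
    (∃ E : ℕ, 0 < E ∧ ∃ B : AbelianVariety K₄,
        B.IsFrobCharpoly ((X ^ 2 - C (2 : ℤ) * X + C ((2 : ℤ) ^ 2)) ^ E)) ∧
      (∃ E : ℕ, 0 < E ∧ ∃ B : AbelianVariety K₄₉,
        B.IsFrobCharpoly ((X ^ 2 - C (7 : ℤ) * X + C ((7 : ℤ) ^ 2)) ^ E)) :=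
  ⟨exists_pow_geometric_traceSq (t := 2) hHT₄ (by rw [h4]; norm_num),
    exists_pow_geometric_traceSq (t := 7) hHT₄₉ (by rw [h49]; norm_num)⟩

end Summit.RiemannHypothesis.RiemannHypothesis.Theorems.MotivicDoor.FunctionField
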